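import Mathlib
import Summits.ValiantsHypothesis.ValiantsHypothesis.Theorems.NewtonUnitEquationsDissociatedUniformTotalsLaw
import Literature.Computability.AlgebraicComplexity.NewtonPolygonTauTransfer
import HarnessLib

/-!
# Crux `NewtonUnitEquations.DissociatedUniform` (stmt-ValiantsHypothesis-5905): totals law — the constant must be at least `2`

Companion of `…DissociatedUniformTotalsLaw`.  The critic's read of the typed law (val-idea-crit-3 g2, 2026-08-28) asks that any
registration of `TotalsLaw.TotalsLawThree C` name `C ≥ 2`: the `c`-constant extremiser (every class is the full pair sumset
`A + B` with `V(A) + V(B)` vertices) gives `T = 2q²` exactly.  This file puts the smallest instance in the kernel: over the label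
group `ZMod 2` with `a x = (ind x, 0)`, `b y = (0, ind y)` (`ind` = the `{0,1}`-value of a label), `c ≡ 0`, both classes are the unit square `{0, e₁, e₂, e₁ + e₂}` (four
strictly exposed points each), so `T = 8 > 1 · 2²`:
* `TotalsLaw.not_totalsLawThree_one : ¬ TotalsLawThree 1` (hence the conjectured constant of record is `C = 2`, attained);
* `TotalsLaw.totalsLawThree_mono`, `TotalsLaw.not_totalsLawThree_zero`, and `TotalsLawN`-free corollary
  `not_totalsLawThreeCyclic_one`.
Conjectured constants of record (memo `Cruxes/DissociatedUniform/NOTES-t1.md` §1, critic read): `C = 2` for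
`TotalsLawThree` / `TotalsLawThreeCyclic` (sharp), `C = 1` for `TotalsLawN.TotalsLawGeneral` (data `(n-1)q²`; `q = 2`:
`T(n,2) = 4(n-1)` exactly), `C = 0 + O(q)` for `FibreSumDominance`.  Nothing about the laws themselves is claimed.
[folklore]
-/

set_option linter.dupNamespace false -- `ValiantsHypothesis.ValiantsHypothesis` (summit = problem) in every name

open scoped BigOperators
open Matrix

namespace Summit.ValiantsHypothesis.ValiantsHypothesis.Theorems.NewtonUnitEquationsDissociatedUniform

namespace TotalsLaw

/-- The weak law is monotone in its constant. -/
theorem totalsLawThree_mono {C C' : ℕ} (hCC' : C ≤ C') (h : TotalsLawThree C) : TotalsLawThree C' :=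
  fun G _ _ a b c => (h G a b c).trans (Nat.mul_le_mul_right _ hCC')

/-- The `{0,1}`-valued coordinate of a label in `ZMod 2`. -/
noncomputable def ind (x : ZMod 2) : ℝ := if x = 0 then 0 else 1

/-- `ind x ∈ {0, 1}`. -/
theorem ind_cases (x : ZMod 2) : ind x = 0 ∨ ind x = 1 := by
  unfold ind; split_ifs <;> simp

/-- The witness curves over `ZMod 2`: `a x = (x, 0)`. -/
noncomputable def sqA (x : ZMod 2) : Fin 2 → ℝ := ![ind x, 0]

/-- The witness curves over `ZMod 2`: `b y = (0, y)`. -/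
noncomputable def sqB (y : ZMod 2) : Fin 2 → ℝ := ![0, ind y]

/-- With `c ≡ 0` every class of the witness is the unit square: the corner `(ind x, ind y)` belongs to every class. -/
theorem corner_mem_classPts (s x y : ZMod 2) :
    (![ind x, ind y] : Fin 2 → ℝ) ∈ classPts sqA sqB (fun _ => (0 : Fin 2 → ℝ)) s := by
  refine ⟨(x, y), ?_⟩
  simp only [sqA, sqB, add_zero]
  ext i
  fin_cases i <;> simp

/-- Every corner `(u, v)`, `u, v ∈ {0, 1}`, belongs to every class. -/
theorem mem_classPts_of_corner (s : ZMod 2) (u v : ℝ) (hu : u = 0 ∨ u = 1) (hv : v = 0 ∨ v = 1) :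
    (![u, v] : Fin 2 → ℝ) ∈ classPts sqA sqB (fun _ => (0 : Fin 2 → ℝ)) s := by
  have h0 : ind 0 = 0 := by simp [ind]
  have h1 : ind 1 = 1 := by
    have : (1 : ZMod 2) ≠ 0 := by decide
    simp [ind, this]
  rcases hu with rfl | rfl <;> rcases hv with rfl | rfl
  · simpa [h0] using corner_mem_classPts s 0 0
  · simpa [h0, h1] using corner_mem_classPts s 0 1
  · simpa [h0, h1] using corner_mem_classPts s 1 0
  · simpa [h1] using corner_mem_classPts s 1 1

/-- Every point of a class of the witness is a corner `(u, v)` with `u, v ∈ {0, 1}`. -/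
theorem exists_corner_of_mem_classPts {s : ZMod 2} {q : Fin 2 → ℝ}
    (hq : q ∈ classPts sqA sqB (fun _ => (0 : Fin 2 → ℝ)) s) :
    ∃ u v : ℝ, (u = 0 ∨ u = 1) ∧ (v = 0 ∨ v = 1) ∧ q = ![u, v] := by
  obtain ⟨⟨x, y⟩, rfl⟩ := hq
  refine ⟨ind x, ind y, ind_cases x, ind_cases y, ?_⟩
  simp only [sqA, sqB, add_zero]
  ext i
  fin_cases i <;> simp

/-- The corner `(x, y)` is strictly exposed by the functional `p ↦ σ p₀ + τ p₁` with `σ = 2x - 1`, `τ = 2y - 1` (signs pointing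
to the corner), hence an extreme point of the class hull. -/
theorem corner_mem_extremePoints (s : ZMod 2) (u v : ℝ) (hu : u = 0 ∨ u = 1) (hv : v = 0 ∨ v = 1) :
    (![u, v] : Fin 2 → ℝ) ∈ (convexHull ℝ (classPts sqA sqB (fun _ => (0 : Fin 2 → ℝ)) s)).extremePoints ℝ := by
  -- the corner is in the class
  have hmem : (![u, v] : Fin 2 → ℝ) ∈ classPts sqA sqB (fun _ => (0 : Fin 2 → ℝ)) s := mem_classPts_of_corner s u v hu hv
  -- the exposing functional
  let l : (Fin 2 → ℝ) →ₗ[ℝ] ℝ := (2 * u - 1) • LinearMap.proj 0 + (2 * v - 1) • LinearMap.proj 1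
  have hl : ∀ p : Fin 2 → ℝ, l p = (2 * u - 1) * p 0 + (2 * v - 1) * p 1 := fun p => by simp [l]
  refine Literature.Computability.AlgebraicComplexity.KPTT.mem_extremePoints_convexHull_of_linear hmem l ?_
  intro q hq hne
  obtain ⟨u', v', hu', hv', rfl⟩ := exists_corner_of_mem_classPts hq
  rw [hl, hl]
  simp only [Matrix.cons_val_zero, Matrix.cons_val_one]
  -- `q ≠ p` rules out the equal corner; the other three are strictly worse
  have hne' : ¬ (u' = u ∧ v' = v) := by
    rintro ⟨rfl, rfl⟩
    exact hne rfl
  rcases hu with rfl | rfl <;> rcases hv with rfl | rfl <;> rcases hu' with rfl | rfl <;> rcases hv' with rfl | rfl <;>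
    first
    | exact absurd ⟨rfl, rfl⟩ hne'
    | norm_num

/-- **Each class of the witness has at least four hull vertices.** -/
theorem four_le_classVert (s : ZMod 2) : 4 ≤ classVert sqA sqB (fun _ => (0 : Fin 2 → ℝ)) s := by
  classical
  unfold classVert
  -- the four corners as a finset
  set K : Finset (Fin 2 → ℝ) := {![0, 0], ![0, 1], ![1, 0], ![1, 1]} with hK
  have hKcard : K.card = 4 := by
    have h01 : (![0, 0] : Fin 2 → ℝ) ≠ ![0, 1] := fun h => by simpa using congr_fun h 1
    have h02 : (![0, 0] : Fin 2 → ℝ) ≠ ![1, 0] := fun h => by simpa using congr_fun h 0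
    have h03 : (![0, 0] : Fin 2 → ℝ) ≠ ![1, 1] := fun h => by simpa using congr_fun h 0
    have h12 : (![0, 1] : Fin 2 → ℝ) ≠ ![1, 0] := fun h => by simpa using congr_fun h 0
    have h13 : (![0, 1] : Fin 2 → ℝ) ≠ ![1, 1] := fun h => by simpa using congr_fun h 0
    have h23 : (![1, 0] : Fin 2 → ℝ) ≠ ![1, 1] := fun h => by simpa using congr_fun h 1
    rw [hK, Finset.card_insert_of_notMem, Finset.card_insert_of_notMem, Finset.card_insert_of_notMem,
      Finset.card_singleton]
    · simp [h23]
    · simp [h12, h13]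
    · simp [h01, h02, h03]
  have hsub : (K : Set (Fin 2 → ℝ)) ⊆
      (convexHull ℝ (classPts sqA sqB (fun _ => (0 : Fin 2 → ℝ)) s)).extremePoints ℝ := by
    intro p hp
    rw [hK] at hp
    simp only [Finset.coe_insert, Finset.coe_singleton, Set.mem_insert_iff, Set.mem_singleton_iff] at hp
    rcases hp with rfl | rfl | rfl | rfl
    · exact corner_mem_extremePoints s 0 0 (Or.inl rfl) (Or.inl rfl)
    · exact corner_mem_extremePoints s 0 1 (Or.inl rfl) (Or.inr rfl)
    · exact corner_mem_extremePoints s 1 0 (Or.inr rfl) (Or.inl rfl)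
    · exact corner_mem_extremePoints s 1 1 (Or.inr rfl) (Or.inr rfl)
  have hfin : ((convexHull ℝ (classPts sqA sqB (fun _ => (0 : Fin 2 → ℝ)) s)).extremePoints ℝ).Finite :=
    (Set.finite_range _).subset extremePoints_convexHull_subset
  calc 4 = K.card := hKcard.symm
    _ = (K : Set (Fin 2 → ℝ)).ncard := (Set.ncard_coe_finset K).symm
    _ ≤ _ := Set.ncard_le_ncard hsub hfin

/-- **The totals law fails with constant `1`**: the `ZMod 2` unit-square witness has `T = 8 > 1 · 2²`.  So the conjectured
constant of record for `TotalsLawThree` is `C = 2` (attained by the `c`-constant extremisers, cf. `totalVert_const_le`). -/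
theorem not_totalsLawThree_one : ¬ TotalsLawThree 1 := by
  intro h
  have hT := h (ZMod 2) sqA sqB (fun _ => 0)
  have h8 : 8 ≤ totalVert sqA sqB (fun _ => (0 : Fin 2 → ℝ)) := by
    unfold totalVert
    calc 8 = ∑ _s : ZMod 2, 4 := by simp
      _ ≤ ∑ s : ZMod 2, classVert sqA sqB (fun _ => (0 : Fin 2 → ℝ)) s := Finset.sum_le_sum fun s _ => four_le_classVert s
  have hcard : Fintype.card (ZMod 2) = 2 := ZMod.card 2
  rw [hcard] at hT
  omega

/-- Hence also `¬ TotalsLawThree 0`. -/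
theorem not_totalsLawThree_zero : ¬ TotalsLawThree 0 := fun h => not_totalsLawThree_one (totalsLawThree_mono zero_le_one h)

/-- The same witness refutes the cyclic form with constant `1`: `¬ TotalsLawThreeCyclic 1`. -/
theorem not_totalsLawThreeCyclic_one : ¬ TotalsLawThreeCyclic 1 := by
  intro h
  have hT := h 2 sqA sqB (fun _ => 0)
  have h8 : 8 ≤ totalVert sqA sqB (fun _ => (0 : Fin 2 → ℝ)) := by
    unfold totalVert
    calc 8 = ∑ _s : ZMod 2, 4 := by simp
      _ ≤ ∑ s : ZMod 2, classVert sqA sqB (fun _ => (0 : Fin 2 → ℝ)) s := Finset.sum_le_sum fun s _ => four_le_classVert s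
  omega

end TotalsLaw

end Summit.ValiantsHypothesis.ValiantsHypothesis.Theorems.NewtonUnitEquationsDissociatedUniform
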